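import Literature.Probability.Percolation.Percolation
import Mathlib.Combinatorics.SimpleGraph.Connectivity.Finite
import Mathlib.Combinatorics.SimpleGraph.Paths
import HarnessLib

/-!
# `NoHeavyLowerTail` (stmt-CriticalPhenomena-4575) — antithetic cluster pairs: a COMPUTABLE cluster (breadth-first closure) for
# certificate checking (prim-hp-2 gen 58)

Support file (`--supports stmt-CriticalPhenomena-4575`, hull-port prover `prim-hp-2`, gen 58).  Two DEFINITIONS (computable) and their
correctness; no named facts, no sorries; standard axioms.

The certificate files of the one-sided programme (…AntitheticCherryOplus, …AntitheticVectorCert and the instance files generated by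
HOME/code/gen58/lab58/gen_oplus_lean.py) evaluate vertex clusters of explicit small graphs by `native_decide`.  With Mathlib's generic
`DecidableRel Reachable` (which enumerates all walks of length `< |V|`) this is exponential in `|V|` (10 s on `Fin 5`, 275 s on `Fin 10`).
Here: `Antithetic.reachStep E S = S ∪ {v | ∃ u ∈ S, s(u,v) ∈ E}` and `Antithetic.reachN E s k` = its `k`-fold iterate from `{s}` (a BFS ball),
with `Antithetic.mem_reachN_iff`: for `k + 1 ≥ Fintype.card V`, `v ∈ reachN E s k ↔ (SimpleGraph.fromEdgeSet ↑E).Reachable s v`, hence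
`Antithetic.openCluster_eq_coe_reachN`: `openCluster ↑E s = ↑(reachN E s k)` — so cluster computations become polynomial.
[cite: VandenbergHaggstromKahn2005, §1 p. 3 (open cluster `C_s`)]
-/

namespace Summit.CriticalPhenomena.PercolationContinuityZ3.Theorems

open Literature.Probability.Percolation

namespace Antithetic

variable {V : Type*} [Fintype V] [DecidableEq V]

/-- One breadth-first step: add all `E`-neighbours of `S`. [this work] -/
def reachStep (E : Finset (Sym2 V)) (S : Finset V) : Finset V :=
  S ∪ Finset.univ.filter fun v => ∃ u ∈ S, s(u, v) ∈ E

/-- The `k`-fold breadth-first ball of `s` in the edge set `E`. [this work] -/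
def reachN (E : Finset (Sym2 V)) (s : V) : ℕ → Finset V
  | 0 => {s}
  | k + 1 => reachStep E (reachN E s k)

/-- A BFS step only adds vertices. [this work] -/
theorem subset_reachStep (E : Finset (Sym2 V)) (S : Finset V) : S ⊆ reachStep E S :=
  Finset.subset_union_left

/-- An `E`-neighbour of `S` lies in `reachStep E S`. [this work] -/
theorem mem_reachStep_of_mem_edge {E : Finset (Sym2 V)} {S : Finset V} {u v : V} (hu : u ∈ S) (he : s(u, v) ∈ E) :
    v ∈ reachStep E S :=
  Finset.mem_union_right _ (Finset.mem_filter.2 ⟨Finset.mem_univ _, u, hu, he⟩)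

/-- The centre lies in every ball. [this work] -/
theorem self_mem_reachN (E : Finset (Sym2 V)) (s : V) : ∀ k, s ∈ reachN E s k
  | 0 => Finset.mem_singleton_self _
  | k + 1 => subset_reachStep E _ (self_mem_reachN E s k)

/-- Balls grow with the radius (one step). [this work] -/
theorem reachN_subset_succ (E : Finset (Sym2 V)) (s : V) (k : ℕ) : reachN E s k ⊆ reachN E s (k + 1) :=
  subset_reachStep E _

/-- Balls grow with the radius. [this work] -/
theorem reachN_mono (E : Finset (Sym2 V)) (s : V) {k l : ℕ} (hkl : k ≤ l) : reachN E s k ⊆ reachN E s l := by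
  induction hkl with
  | refl => exact le_rfl
  | step _ ih => exact ih.trans (reachN_subset_succ E s _)

/-- Every vertex of the BFS ball is reachable. [this work] -/
theorem reachable_of_mem_reachN (E : Finset (Sym2 V)) (s : V) :
    ∀ k, ∀ v ∈ reachN E s k, (SimpleGraph.fromEdgeSet (↑E : Set (Sym2 V))).Reachable s v
  | 0, v, hv => by
      rw [reachN, Finset.mem_singleton] at hv
      subst hv; exact SimpleGraph.Reachable.refl _
  | k + 1, v, hv => by
      rw [reachN, reachStep, Finset.mem_union, Finset.mem_filter] at hv
      rcases hv with hv | ⟨_, u, hu, he⟩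
      · exact reachable_of_mem_reachN E s k v hv
      · have hsu := reachable_of_mem_reachN E s k u hu
        by_cases huv : u = v
        · exact huv ▸ hsu
        · have hadj : (SimpleGraph.fromEdgeSet (↑E : Set (Sym2 V))).Adj u v := by
            rw [SimpleGraph.fromEdgeSet_adj]; exact ⟨Finset.mem_coe.2 he, huv⟩
          exact hsu.trans hadj.reachable

/-- A walk of length `l` from a vertex of the `k`-ball ends in the `(k + l)`-ball. [this work] -/
theorem mem_reachN_of_walk (E : Finset (Sym2 V)) (s : V) :
    ∀ {u v : V} (p : (SimpleGraph.fromEdgeSet (↑E : Set (Sym2 V))).Walk u v) (k : ℕ),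
      u ∈ reachN E s k → v ∈ reachN E s (k + p.length)
  | _, _, SimpleGraph.Walk.nil, k, hu => by simpa using hu
  | _, _, SimpleGraph.Walk.cons hadj q, k, hu => by
      rw [SimpleGraph.fromEdgeSet_adj] at hadj
      have hw := mem_reachStep_of_mem_edge hu (Finset.mem_coe.1 hadj.1)
      have h := mem_reachN_of_walk E s q (k + 1) hw
      simp only [SimpleGraph.Walk.length_cons]
      have e : k + (q.length + 1) = k + 1 + q.length := by ring
      rw [e]; exact h

/-- **Correctness of the BFS ball**: for `Fintype.card V ≤ k + 1`, `v ∈ reachN E s k` iff `v` is reachable from `s` along `E`.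
[this work] -/
theorem mem_reachN_iff (E : Finset (Sym2 V)) (s v : V) {k : ℕ} (hk : Fintype.card V ≤ k + 1) :
    v ∈ reachN E s k ↔ (SimpleGraph.fromEdgeSet (↑E : Set (Sym2 V))).Reachable s v := by
  refine ⟨reachable_of_mem_reachN E s k v, fun h => ?_⟩
  obtain ⟨p⟩ := h
  have hp := mem_reachN_of_walk E s (p.toPath : (SimpleGraph.fromEdgeSet (↑E : Set (Sym2 V))).Walk s v) 0 (self_mem_reachN E s 0)
  have hlen : (p.toPath : (SimpleGraph.fromEdgeSet (↑E : Set (Sym2 V))).Walk s v).length < Fintype.card V :=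
    p.toPath.2.length_lt
  rw [zero_add] at hp
  exact reachN_mono E s (by omega) hp

/-- The open cluster as a computable Finset. [this work] -/
theorem openCluster_eq_coe_reachN (E : Finset (Sym2 V)) (s : V) {k : ℕ} (hk : Fintype.card V ≤ k + 1) :
    openCluster (↑E : Set (Sym2 V)) s = ↑(reachN E s k) := by
  ext v
  rw [Finset.mem_coe, mem_reachN_iff E s v hk]
  rfl

/-- The filter form used by the certificate files equals the BFS ball. [this work] -/
theorem filter_reachable_eq_reachN (E : Finset (Sym2 V)) (s : V) {k : ℕ} (hk : Fintype.card V ≤ k + 1)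
    [DecidablePred fun v => (SimpleGraph.fromEdgeSet (↑E : Set (Sym2 V))).Reachable s v] :
    (Finset.univ.filter fun v => (SimpleGraph.fromEdgeSet (↑E : Set (Sym2 V))).Reachable s v) = reachN E s k := by
  ext v
  rw [Finset.mem_filter, mem_reachN_iff E s v hk]
  simp

end Antithetic

end Summit.CriticalPhenomena.PercolationContinuityZ3.Theorems
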